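import Summits.QuantumFields.BalabanUV.T4Continuum.Support.NE9LevelCountsAnimal
import Summits.QuantumFields.BalabanUV.T4Continuum.Support.B13StepTermShift

/-!
# NE9LevelCountsWindow — the last two DISPLAYED counting fields of the species LEVEL COUNTS `LevelCountsG` ([II] p. 8; the row
# owner's binder structure, `NE9Lemma1Gain`) on the carriers of record `B13Carriers.TwoRuns.carriers`: the □′-COVER `cover`
# (p. 8 l. 1–4) and the □′-COUNT `countQ` (p. 8 l. 9–10 *"This yields (6L)⁴L^jη"*) PRODUCED from a WINDOW READING of a piece
# frame + the NESTING of the record's partitions (kernel count: exactly `#W·L^{4(k−j)}` cubes of `π_j` over a window of `#W`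
# cubes of `π_k`) + ONE letter inequality, discharged in the species END's letters — cell `pub-balaban`, T4-DAG §2 node U3 /
# §6 NE9; rung (B)+1 on a FIXED finite T⁴; NE9 formalisation swarm, unit `b2b-balaban-t4-ne9-formalise-leaf-01` gen 8,
# own-initiative lineage item «LC-WINDOW» (sequel of «LC-REC» p215967 and «LC-127» p216359), journal CLAIM l.11983; nothing
# of any import is modified

HONEST FRAMING (T4-DAG PAGE 1).  Rung (B)+1 = existence and uniqueness of the ε → 0 limit of gauge-invariant observables on a
FIXED finite torus T⁴ — NOT infinite volume, NOT a mass gap, NOT the Clay problem.  NE9 (`T4OutputRate.NE9` ∧ `FadingMemory`) is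
a cell NEW ESTIMATE, NOT PRINTED and NOT discharged here («NE9 ⇐ the named binders»); spine 0/9; 0/18 skeleton leaves
instantiated on Bałaban's objects (O-NE9-1).  HONEST DEPENDENCY (cell line, verbatim): continuum YM on T⁴ ⇐ BetaPertH ∧ nine spine
estimates (0/9 proved); BetaPertH ⇐ (D1) ∧ (D4) ∧ CAP+tail; G-an2-4 gates asym, D1 and NE2/3/4.  `FlowStep.BetaPertH`, (B), (B^μ)
do not occur.  [II] = [Balaban1988RG2Cluster] (CMP **116**) is quoted for TYPES only (ABSOLUTE RULE: nothing printed in the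
audited series is asserted): p. 8 l. 1–4 *"We take X∈𝐃_j, X ⊂ □̃². This sum can be bounded by two sums, the first is over
□′∈π_j, □′ ⊂ □̃², the second over X∈𝐃_j such that □′ ⊂ X"*, l. 9–10 *"To bound the first sum, over □′ ⊂ □̃², we use the
factor (L^jη)⁵ in (1.24). This yields (6L)⁴L^jη"*.

WHERE THIS SITS.  Every species END of the NE9 programme displays `LevelCountsG D.toC.frame κ κ₁ O1 c_Q gain ℓ′` (five fields:
`cover`, `sumX` (1.26), `countQ`, `sumY` (1.27), `count0` (1.28)).  «LC-REC» (`NE9LevelCountsRecord`) produced `sumX`/`count0` and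
«LC-127» (`NE9LevelCountsAnimal`) produced `sumY` on the carriers of record modulo identification readings; `cover` and `countQ`
stayed displayed (typer DAG §1D rows 8–9).  THIS FILE produces them, for ANY piece frame `P : PieceData C …` over ANY carriers
`C`, from a WINDOW READING: the counting cubes `P.Sq k y □₀ j` read (`rq`, injective and exhaustive) as the cubes □′ ∈ π_j whose
π_k-ancestor — NE5-leaf-02's coarsening `B13InnerData.coarsen R j k` (integer quotient of the cube index by `L^{k−j}`) BY NAME —
lies in a WINDOW `W k y □₀` of at most `w` cubes of π_k; the sources `P.src` read (LC-REC's `rd`) as scale-`j` domains whose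
footprint lies over the window (*"X ⊂ □̃²"*); the fibres `P.SX … □′` read ⊇ the sources through □′ (*"X ⊃ □′"*).  The window
is a LETTER: which cubes □̃₀² consists of on Bałaban's (1.33) objects is O-NE9-1 and is NOT decided here.
* §1 (generic, nested tori `ℤ/(cN′) → ℤ/N′` by `val / c`): `card_filter_val_div_eq` (each digit class has `c` members),
  `card_fibre_quot` (`c^d` per point), **`card_filter_quot_mem`** (a window `W` of `(ℤ/N′)^d` has exactly `#W·c^d` points of
  `(ℤ/N)^d` over it);
* §2 (the record; nesting `cubesPerDir j = L^{k−j}·cubesPerDir k` for `j ≤ k ≤ m+K−m′` is NE5-leaf-02's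
  `B13StepTermShift.cubesPerDir_eq_pow_mul` BY NAME), `coarsen_eq_quot`, **`card_filter_coarsen_mem(_real)`**: EXACTLY `#W·(L^{k−j})⁴ = #W·(L⁴)^{k−j}` cubes
  of π_j over a window `W` of cubes of π_k — print's *"(6L)⁴(L^jη)^{−4}"*-type count with `(L^jη)^{−1} = L^{k−j}` cubes of π_j per
  cube of π_k per direction, the window size `(6L)⁴` being the letter `w`;
* §3 (the fields, owner's shapes verbatim): `card_Sq_le_of_window` (`#P.Sq k y □₀ j ≤ w·(L⁴)^{k−j}`), **`countQ_of_window`**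
  (the field `countQ` modulo ONE displayed letter inequality `w·(L⁴)^{k−j}·gain k j ≤ c_Q·ℓ′ k j`), `letters_of_perLevel` /
  `perLevel_printed` / **`countQ_of_window_agePow`** (the letter inequality DISCHARGED in the species END's letters
  `gain = (agePow θ)⁵`, `τ = c_Q·agePow ω` from `L⁴·θ⁵ ≤ ω` and `w ≤ c_Q` — print: `θ = L⁻¹` per step of «L^jη», `L⁴θ⁵ = L⁻¹ ≤
  ω = L^{−α}` for the rate exponent `α ≤ 1` of O-ne9p1g23-1, and `c_Q = (6L)⁴ = w` is `NE9Lemma1Counting.tauOf`), **`cover_of_window`**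
  (the field `cover`), `card_Sq_eq_of_window` (consistency: under the full reading the count is EXACT).
The five-field assembly with LC-REC/LC-127 is the sequel module `NE9LevelCountsRecordFive`.
DISGUISE TEST: finite combinatorics on the cell's torus model composed BY NAME with NE5-leaf-02's coarsening; the readings
`rd`/`rq`/`W` of a species frame on Bałaban's objects are O-NE9-1; no activity, no history, no estimate of the series — not NE9,
not NE5.  Value = bookkeeping: the two remaining displayed counting fields of every species END become kernel on the carriers of
record modulo identification readings + one letter inequality (itself discharged in the END's letters), NOT summit progress.

References (TYPES only): T. Bałaban, *Renormalization group approach to lattice gauge field theories. II. Cluster expansions*,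
Commun. Math. Phys. **116** (1988) 1–22 [Balaban1988RG2Cluster], (1.24)–(1.27) pp. 7–8 (render
`b2b-balaban-ref1/pages/1988-cmp116-rg-II-cluster/…-p007/p008-x2.png` re-read as images by this seat, 2026-08-20); *I*, Commun.
Math. Phys. **109** (1987) 249–301 [Balaban1987RG1], p. 257 (the cubes of π_j, centres on `T^{(j+m)}`).  Summits-side NEW work
(LEAN PLACEMENT RULE); imports «LC-127» `NE9LevelCountsAnimal` (p216359, this lineage) and `B13StepTermShift` (NE5-leaf-02; for `B13InnerData.coarsen`
and `cubesPerDir_eq_pow_mul`) ONLY;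
modifies nothing; 0 `def`, 0 `def … : Prop`, 0 sorry; axioms ⊆ {propext, Classical.choice, Quot.sound}.
-/

noncomputable section

open scoped BigOperators

namespace Summit.QuantumFields.BalabanUV.T4Continuum.NE9LevelCountsWindow

open Literature.MathematicalPhysics.QuantumFieldTheory.Balaban1983to89
open Literature.MathematicalPhysics.QuantumFieldTheory.Balaban1983to89.T4OutputRate (Carriers)
open Literature.MathematicalPhysics.QuantumFieldTheory.Balaban1983to89.TreeLengthTorus (TPt TFaceConnected TDom)
open Summit.QuantumFields.BalabanUV.T4Continuum.B13Carriers (TwoRuns)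
open Summit.QuantumFields.BalabanUV.T4Continuum.B13DomainGeometryTR
open Summit.QuantumFields.BalabanUV.T4Continuum.B13InnerData (coarsen coarsen_apply)
open Summit.QuantumFields.BalabanUV.T4Continuum.B13StepTermShift (cubesPerDir_eq_pow_mul)
open Summit.QuantumFields.BalabanUV.T4Continuum.NE9Lemma1Counting
open Summit.QuantumFields.BalabanUV.T4Continuum.NE9Lemma1Gain
open Summit.QuantumFields.BalabanUV.T4Continuum.NE9LevelCountsRecord
open Summit.QuantumFields.BalabanUV.T4Continuum.NE9LevelCountsAnimal (sumY_of_record levelCountsG_of_record₃)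

/-! ## §1 Generic: the fibres of the coarsening map between nested tori -/

section Nested

variable {d N N' c : ℕ}

/-- One coordinate: on `ℤ/N` with `N = c·N'`, the class `{z : z.val / c = t}` of a digit `t < N'` has exactly `c` members
(`val` is a bijection onto `[0, N)` and the class is the interval `[c·t, c·t + c)`). [folklore] -/
theorem card_filter_val_div_eq [NeZero N] (hc : 0 < c) (hN : N = c * N') {t : ℕ} (ht : t < N') :
    ((Finset.univ : Finset (ZMod N)).filter fun z => z.val / c = t).card = c := by
  classical
  have hle : c * t + c ≤ N := by
    rw [hN]
    calc c * t + c = c * (t + 1) := by ring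
      _ ≤ c * N' := Nat.mul_le_mul_left c ht
  have himg : ((Finset.univ : Finset (ZMod N)).filter fun z => z.val / c = t).image ZMod.val = Finset.Ico (c * t) (c * t + c) := by
    ext v
    simp only [Finset.mem_image, Finset.mem_filter, Finset.mem_univ, true_and, Finset.mem_Ico]
    constructor
    · rintro ⟨z, hz, rfl⟩
      constructor
      · have h1 : t ≤ z.val / c := hz.ge
        rw [Nat.le_div_iff_mul_le hc] at h1
        linarith [Nat.mul_comm t c]
      · have h2 : z.val / c < t + 1 := by rw [hz]; exact Nat.lt_succ_self t
        rw [Nat.div_lt_iff_lt_mul hc] at h2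
        linarith [Nat.mul_comm (t + 1) c]
    · rintro ⟨h1, h2⟩
      have hv : v < N := lt_of_lt_of_le h2 hle
      refine ⟨(v : ZMod N), ?_, ?_⟩
      · rw [ZMod.val_natCast, Nat.mod_eq_of_lt hv]
        refine le_antisymm ?_ ?_
        · exact Nat.lt_succ_iff.1 ((Nat.div_lt_iff_lt_mul hc).2 (by linarith [Nat.mul_comm (t + 1) c]))
        · exact (Nat.le_div_iff_mul_le hc).2 (by linarith [Nat.mul_comm t c])
      · rw [ZMod.val_natCast, Nat.mod_eq_of_lt hv]
  rw [← Finset.card_image_of_injective _ (ZMod.val_injective N), himg, Nat.card_Ico]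
  omega

/-- The coarsening digit map of the nested tori, `(q x) i = ⌊x_i / c⌋ (mod N')`. [folklore] -/
theorem quot_eq_iff [NeZero N] [NeZero N'] (hN : N = c * N') (hc : 0 < c) (x : TPt d N) (w : TPt d N') :
    (fun i => ((((x i).val / c : ℕ)) : ZMod N')) = w ↔ ∀ i, (x i).val / c = (w i).val := by
  have hlt : ∀ i, (x i).val / c < N' := fun i => by
    rw [Nat.div_lt_iff_lt_mul hc, Nat.mul_comm]
    rw [← hN]
    exact ZMod.val_lt (x i)
  constructor
  · intro h i
    have hi : ((((x i).val / c : ℕ)) : ZMod N') = w i := congrFun h i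
    rw [← hi, ZMod.val_natCast, Nat.mod_eq_of_lt (hlt i)]
  · intro h
    funext i
    rw [h i, ZMod.natCast_zmod_val]

/-- All coordinates: the fibre of the coarsening map over a point `w` of the coarse torus `(ℤ/N')^d` has exactly `c^d` members.
[folklore] -/
theorem card_fibre_quot [NeZero N] [NeZero N'] (hc : 0 < c) (hN : N = c * N') (w : TPt d N') :
    ((Finset.univ : Finset (TPt d N)).filter fun x => (fun i => ((((x i).val / c : ℕ)) : ZMod N')) = w).card = c ^ d := by
  classical
  have hset : ((Finset.univ : Finset (TPt d N)).filter fun x => (fun i => ((((x i).val / c : ℕ)) : ZMod N')) = w) =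
      Fintype.piFinset fun i => (Finset.univ : Finset (ZMod N)).filter fun z => z.val / c = (w i).val := by
    ext x
    simp only [Finset.mem_filter, Finset.mem_univ, true_and, Fintype.mem_piFinset]
    exact quot_eq_iff hN hc x w
  rw [hset, Fintype.card_piFinset]
  simp only [card_filter_val_div_eq hc hN (ZMod.val_lt (w _)), Finset.prod_const, Finset.card_univ, Fintype.card_fin]

/-- **THE WINDOW COUNT ON NESTED TORI**: over a window `W` of the coarse torus `(ℤ/N')^d`, the fine torus `(ℤ/N)^d`, `N = c·N'`,
has exactly `#W·c^d` points (cubes). [folklore] -/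
theorem card_filter_quot_mem [NeZero N] [NeZero N'] (hc : 0 < c) (hN : N = c * N') (W : Finset (TPt d N')) :
    ((Finset.univ : Finset (TPt d N)).filter fun x => (fun i => ((((x i).val / c : ℕ)) : ZMod N')) ∈ W).card
      = W.card * c ^ d := by
  classical
  rw [Finset.card_eq_sum_card_fiberwise (s := (Finset.univ : Finset (TPt d N)).filter fun x =>
      (fun i => ((((x i).val / c : ℕ)) : ZMod N')) ∈ W) (t := W)
      (f := fun x => fun i => ((((x i).val / c : ℕ)) : ZMod N')) (fun x hx => (Finset.mem_filter.1 hx).2)]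
  have hfib : ∀ w ∈ W, (((Finset.univ : Finset (TPt d N)).filter fun x =>
      (fun i => ((((x i).val / c : ℕ)) : ZMod N')) ∈ W).filter
        fun x => (fun i => ((((x i).val / c : ℕ)) : ZMod N')) = w).card = c ^ d := by
    intro w hw
    rw [Finset.filter_filter]
    have : ((Finset.univ : Finset (TPt d N)).filter fun x =>
        (fun i => ((((x i).val / c : ℕ)) : ZMod N')) ∈ W ∧ (fun i => ((((x i).val / c : ℕ)) : ZMod N')) = w)
        = ((Finset.univ : Finset (TPt d N)).filter fun x => (fun i => ((((x i).val / c : ℕ)) : ZMod N')) = w) := by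
      refine Finset.filter_congr fun x _ => ⟨fun h => h.2, fun h => ⟨?_, h⟩⟩
      rw [h]; exact hw
    rw [this, card_fibre_quot hc hN w]
  rw [Finset.sum_congr rfl hfib, Finset.sum_const, smul_eq_mul]

end Nested

/-! ## §2 On the carriers of record: the cubes of `π_j` over a window of cubes of `π_k` -/

section Record

variable {G : Type} [GaugeGroup G] (R : TwoRuns G)

/-- NE5-leaf-02's coarsening `B13InnerData.coarsen R j k` IS §1's digit map with `c = L^{k−j}` (`coarsen_apply`). [folklore] -/
theorem coarsen_eq_quot (j k : ℕ) (a : TPt 4 (R.cubesPerDir j)) :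
    coarsen R j k a = fun ν => ((((a ν).val / R.F.L ^ (k - j) : ℕ)) : ZMod (R.cubesPerDir k)) :=
  funext fun ν => coarsen_apply R j k a ν

/-- **THE □′-COUNT ON THE CARRIERS OF RECORD**: over a window `W` of cubes of `π_k`, there are EXACTLY `#W · (L^{k−j})⁴` cubes
of `π_j` (those whose `π_k`-ancestor `coarsen R j k □′` lies in `W`), for `j ≤ k` inside the tower.  (Print, [II] p. 8 l. 9–10:
*"To bound the first sum, over □′ ⊂ □̃², we use the factor (L^jη)⁵ in (1.24). This yields (6L)⁴L^jη"* — i.e. a count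
`≤ (6L)⁴(L^jη)^{−4}` of the □′ ⊂ □̃²; here the window is a LETTER `W`, its identification with □̃₀² is O-NE9-1.)
[cite: Balaban1988RG2Cluster, (1.26)-(1.27) p.8] -/
theorem card_filter_coarsen_mem {j k : ℕ} (hjk : j ≤ k) (hk : k + R.m' ≤ R.F.m + R.K)
    (W : Finset (TPt 4 (R.cubesPerDir k))) :
    ((Finset.univ : Finset (TPt 4 (R.cubesPerDir j))).filter fun a => coarsen R j k a ∈ W).card
      = W.card * (R.F.L ^ (k - j)) ^ 4 := by
  classical
  have hL : 0 < R.F.L ^ (k - j) := pow_pos (by linarith [R.F.hL.2]) _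
  rw [← card_filter_quot_mem (d := 4) hL (cubesPerDir_eq_pow_mul R hjk hk) W]
  congr 1
  refine Finset.filter_congr fun a _ => ?_
  rw [coarsen_eq_quot]

/-- The same count in real letters: `#W · (L⁴)^{k−j}`. [folklore] -/
theorem card_filter_coarsen_mem_real {j k : ℕ} (hjk : j ≤ k) (hk : k + R.m' ≤ R.F.m + R.K)
    (W : Finset (TPt 4 (R.cubesPerDir k))) :
    ((((Finset.univ : Finset (TPt 4 (R.cubesPerDir j))).filter fun a => coarsen R j k a ∈ W).card : ℕ) : ℝ)
      = (W.card : ℝ) * ((R.F.L : ℝ) ^ 4) ^ (k - j) := by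
  rw [card_filter_coarsen_mem R hjk hk W]
  push_cast
  rw [← pow_mul, ← pow_mul, Nat.mul_comm]

/-! ## §3 The two fields of the owner's `LevelCountsG` from a WINDOW READING of a piece frame -/

variable {C : Carriers} {Bg ι α β γ : Type}

/-- **THE □′-COUNT OF A FRAME READ OVER A WINDOW.**  If the counting cubes `P.Sq k y a j` read INJECTIVELY (`rq`) as cubes
□′ ∈ π_j whose π_k-ancestor lies in a window `W k y a` of at most `w` cubes of π_k (creation steps `j ≤ k` inside the tower),
then `#P.Sq k y a j ≤ w · (L⁴)^{k−j}`. [cite: Balaban1988RG2Cluster, (1.26)-(1.27) p.8] -/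
theorem card_Sq_le_of_window (P : PieceData C Bg ι α β γ)
    (W : (k : ℕ) → ι → α → Finset (TPt 4 (R.cubesPerDir k))) {w : ℝ}
    (hW : ∀ (k : ℕ) (y : ι) (a : α), ((W k y a).card : ℝ) ≤ w)
    (rq : (k : ℕ) → ι → α → (j : ℕ) → γ → TPt 4 (R.cubesPerDir j))
    (hinj : ∀ (k : ℕ) (y : ι) (a : α) (j : ℕ), Set.InjOn (rq k y a j) ↑(P.Sq k y a j))
    (hrq : ∀ (k : ℕ) (y : ι) (a : α) (j : ℕ), ∀ q ∈ P.Sq k y a j,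
      j ≤ k ∧ k + R.m' ≤ R.F.m + R.K ∧ coarsen R j k (rq k y a j q) ∈ W k y a)
    (k : ℕ) (y : ι) (a : α) (j : ℕ) :
    ((P.Sq k y a j).card : ℝ) ≤ w * ((R.F.L : ℝ) ^ 4) ^ (k - j) := by
  classical
  have hw0 : 0 ≤ w := le_trans (Nat.cast_nonneg _) (hW k y a)
  have hL4 : 0 ≤ ((R.F.L : ℝ) ^ 4) ^ (k - j) := pow_nonneg (pow_nonneg (Nat.cast_nonneg _) 4) _
  rcases (P.Sq k y a j).eq_empty_or_nonempty with he | ⟨q₀, hq₀⟩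
  · rw [he, Finset.card_empty, Nat.cast_zero]
    exact mul_nonneg hw0 hL4
  · obtain ⟨hjk, hk, -⟩ := hrq k y a j q₀ hq₀
    have hsub : (P.Sq k y a j).image (rq k y a j) ⊆
        (Finset.univ : Finset (TPt 4 (R.cubesPerDir j))).filter fun b => coarsen R j k b ∈ W k y a := by
      intro b hb
      obtain ⟨q, hq, rfl⟩ := Finset.mem_image.1 hb
      exact Finset.mem_filter.2 ⟨Finset.mem_univ _, (hrq k y a j q hq).2.2⟩
    have hcard : (((P.Sq k y a j).card : ℕ) : ℝ) ≤ ((W k y a).card : ℝ) * ((R.F.L : ℝ) ^ 4) ^ (k - j) := by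
      rw [← card_filter_coarsen_mem_real R hjk hk (W k y a), ← Finset.card_image_of_injOn (hinj k y a j)]
      exact_mod_cast Finset.card_le_card hsub
    exact hcard.trans (mul_le_mul_of_nonneg_right (hW k y a) hL4)

/-- **THE FIELD `countQ` OF `LevelCountsG` ON THE CARRIERS OF RECORD** — the □′-count against the gain: under the window reading
of `card_Sq_le_of_window` and ONE displayed LETTER inequality `w·(L⁴)^{k−j}·gain k j ≤ c_Q·ℓ′ k j` (`j ≤ k`; plus the signs
`0 ≤ gain`, `0 ≤ c_Q·ℓ′` for the empty levels), `#P.Sq k y a j · gain k j ≤ c_Q · ℓ′ k j` for all `k, y, □₀, j` — the owner's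
field shape verbatim (`NE9Lemma1Gain.LevelCountsG.countQ`). [cite: Balaban1988RG2Cluster, (1.26)-(1.27) p.8] -/
theorem countQ_of_window (P : PieceData C Bg ι α β γ)
    (W : (k : ℕ) → ι → α → Finset (TPt 4 (R.cubesPerDir k))) {w : ℝ}
    (hW : ∀ (k : ℕ) (y : ι) (a : α), ((W k y a).card : ℝ) ≤ w)
    (rq : (k : ℕ) → ι → α → (j : ℕ) → γ → TPt 4 (R.cubesPerDir j))
    (hinj : ∀ (k : ℕ) (y : ι) (a : α) (j : ℕ), Set.InjOn (rq k y a j) ↑(P.Sq k y a j))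
    (hrq : ∀ (k : ℕ) (y : ι) (a : α) (j : ℕ), ∀ q ∈ P.Sq k y a j,
      j ≤ k ∧ k + R.m' ≤ R.F.m + R.K ∧ coarsen R j k (rq k y a j q) ∈ W k y a)
    {cQ : ℝ} {gain ℓ' : ℕ → ℕ → ℝ} (hgain : ∀ k j, 0 ≤ gain k j) (hcQℓ : ∀ k j, 0 ≤ cQ * ℓ' k j)
    (hletters : ∀ k j, j ≤ k → w * ((R.F.L : ℝ) ^ 4) ^ (k - j) * gain k j ≤ cQ * ℓ' k j)
    (k : ℕ) (y : ι) (a : α) (j : ℕ) : ((P.Sq k y a j).card : ℝ) * gain k j ≤ cQ * ℓ' k j := by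
  classical
  rcases (P.Sq k y a j).eq_empty_or_nonempty with he | ⟨q₀, hq₀⟩
  · rw [he, Finset.card_empty, Nat.cast_zero, zero_mul]
    exact hcQℓ k j
  · obtain ⟨hjk, -, -⟩ := hrq k y a j q₀ hq₀
    calc ((P.Sq k y a j).card : ℝ) * gain k j ≤ w * ((R.F.L : ℝ) ^ 4) ^ (k - j) * gain k j :=
          mul_le_mul_of_nonneg_right (card_Sq_le_of_window R P W hW rq hinj hrq k y a j) (hgain k j)
      _ ≤ cQ * ℓ' k j := hletters k j hjk

/-- **THE LETTER INEQUALITY, DISCHARGED PER LEVEL**: if one creation level costs a factor `Λ` in cubes and gains `θ⁵`, with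
`Λ·θ⁵ ≤ ω`, and `w ≤ c_Q`, then `w·Λ^{k−j}·(θ^{k−j})⁵ ≤ c_Q·ω^{k−j}`.  Printed letters: `Λ = L⁴`, `θ = L⁻¹` (one step of
«L^jη»), `Λθ⁵ = L⁻¹ ≤ ω = L^{−α}` for a rate exponent `α ≤ 1`. [folklore] -/
theorem letters_of_perLevel {Λ θ ω w cQ : ℝ} (hΛ : 0 ≤ Λ) (hθ : 0 ≤ θ) (hper : Λ * θ ^ 5 ≤ ω) (hw0 : 0 ≤ w)
    (hw : w ≤ cQ) (k j : ℕ) : w * Λ ^ (k - j) * (θ ^ (k - j)) ^ 5 ≤ cQ * ω ^ (k - j) := by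
  have h0 : 0 ≤ Λ * θ ^ 5 := mul_nonneg hΛ (pow_nonneg hθ 5)
  have h1 : Λ ^ (k - j) * (θ ^ (k - j)) ^ 5 = (Λ * θ ^ 5) ^ (k - j) := by
    rw [mul_pow, ← pow_mul, ← pow_mul, Nat.mul_comm]
  rw [mul_assoc, h1]
  exact mul_le_mul hw (pow_le_pow_left₀ h0 hper _) (pow_nonneg h0 _) (hw0.trans hw)

/-- The printed per-level letters: `L⁴ · (L⁻¹)⁵ = L⁻¹` (`L ≠ 0`). [folklore] -/
theorem perLevel_printed {L : ℝ} (hL : L ≠ 0) : L ^ 4 * (L⁻¹) ^ 5 = L⁻¹ := by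
  field_simp

/-- **`countQ` IN THE SPECIES END's LETTERS** (`gain = (agePow θ)⁵`, `τ = c_Q · agePow ω`, `NE9Lemma1Gain.agePow ω k j = ω^{k−j}`):
the window reading + `L⁴·θ⁵ ≤ ω` + `w ≤ c_Q` give the field with NO displayed letter inequality.
[cite: Balaban1988RG2Cluster, (1.26)-(1.27) p.8] -/
theorem countQ_of_window_agePow (P : PieceData C Bg ι α β γ)
    (W : (k : ℕ) → ι → α → Finset (TPt 4 (R.cubesPerDir k))) {w : ℝ}
    (hW : ∀ (k : ℕ) (y : ι) (a : α), ((W k y a).card : ℝ) ≤ w)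
    (rq : (k : ℕ) → ι → α → (j : ℕ) → γ → TPt 4 (R.cubesPerDir j))
    (hinj : ∀ (k : ℕ) (y : ι) (a : α) (j : ℕ), Set.InjOn (rq k y a j) ↑(P.Sq k y a j))
    (hrq : ∀ (k : ℕ) (y : ι) (a : α) (j : ℕ), ∀ q ∈ P.Sq k y a j,
      j ≤ k ∧ k + R.m' ≤ R.F.m + R.K ∧ coarsen R j k (rq k y a j q) ∈ W k y a)
    {θ ω cQ : ℝ} (hθ : 0 ≤ θ) (hper : (R.F.L : ℝ) ^ 4 * θ ^ 5 ≤ ω) (hw : w ≤ cQ)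
    (k : ℕ) (y : ι) (a : α) (j : ℕ) :
    ((P.Sq k y a j).card : ℝ) * (agePow θ k j) ^ 5 ≤ cQ * agePow ω k j := by
  have hw0 : 0 ≤ w := le_trans (Nat.cast_nonneg _) (hW k y a)
  have hL4 : 0 ≤ (R.F.L : ℝ) ^ 4 := pow_nonneg (Nat.cast_nonneg _) 4
  have hω : 0 ≤ ω := le_trans (mul_nonneg hL4 (pow_nonneg hθ 5)) hper
  refine countQ_of_window R P W hW rq hinj hrq (gain := fun k j => (agePow θ k j) ^ 5) (ℓ' := agePow ω)
    (fun k j => pow_nonneg (pow_nonneg hθ _) 5) (fun k j => mul_nonneg (hw0.trans hw) (pow_nonneg hω _)) ?_ k y a j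
  intro k j _
  exact letters_of_perLevel hL4 hθ hper hw0 hw k j

/-- **THE FIELD `cover` OF `LevelCountsG` ON THE CARRIERS OF RECORD** — the □′-cover of the sources ([II] p. 8 l. 1–4: *"We take
X∈𝐃_j, X ⊂ □̃². This sum can be bounded by two sums, the first is over □′∈π_j, □′ ⊂ □̃², the second over X∈𝐃_j such that
□′ ⊂ X"*): if the sources `P.src k y a j` read (LC-REC's `rd`) as scale-`j` domains of the record whose footprint lies over
the window (`j ≤ k` inside the tower), the counting cubes EXHAUST the window's cubes of `π_j` (`rq` onto), and the fibre
`P.SX k y a j q` CONTAINS every source through the cube `□′ = rq q`, then every source lies in the fibre of one of its own cubes.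
[cite: Balaban1988RG2Cluster, (1.26) p.8] -/
theorem cover_of_window (P : PieceData C Bg ι α β γ) (rd : C.Dom → R.carriers.Dom)
    (W : (k : ℕ) → ι → α → Finset (TPt 4 (R.cubesPerDir k)))
    (rq : (k : ℕ) → ι → α → (j : ℕ) → γ → TPt 4 (R.cubesPerDir j))
    (hsrc : ∀ (k : ℕ) (y : ι) (a : α) (j : ℕ), ∀ x ∈ P.src k y a j,
      j ≤ k ∧ k + R.m' ≤ R.F.m + R.K ∧ rd x ∈ R.domAt j ∧ ∀ c ∈ footprint (rd x), coarsen R c.1 k c.2 ∈ W k y a)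
    (hsurj : ∀ (k : ℕ) (y : ι) (a : α) (j : ℕ), j ≤ k → k + R.m' ≤ R.F.m + R.K →
      ∀ b : TPt 4 (R.cubesPerDir j), coarsen R j k b ∈ W k y a → ∃ q ∈ P.Sq k y a j, rq k y a j q = b)
    (hSXsup : ∀ (k : ℕ) (y : ι) (a : α) (j : ℕ), ∀ q ∈ P.Sq k y a j, ∀ x ∈ P.src k y a j,
      (⟨j, rq k y a j q⟩ : SCube R) ∈ footprint (rd x) → x ∈ P.SX k y a j q)
    (k : ℕ) (y : ι) (a : α) (j : ℕ) : ∀ x ∈ P.src k y a j, ∃ q ∈ P.Sq k y a j, x ∈ P.SX k y a j q := by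
  intro x hx
  obtain ⟨hjk, hk, hdom, hwin⟩ := hsrc k y a j x hx
  have hscale : (rd x).1 = j := by simpa using hdom
  obtain ⟨⟨c1, c2⟩, hc⟩ := footprint_nonempty (rd x)
  have hc1 : c1 = j := (fst_eq_of_mem_footprint hc).trans hscale
  subst hc1
  obtain ⟨q, hq, hqc⟩ := hsurj k y a _ hjk hk c2 (hwin _ hc)
  exact ⟨q, hq, hSXsup k y a _ q hq x hx (by rw [hqc]; exact hc)⟩

/-- CONSISTENCY OF THE WINDOW READING: when `rq` is injective, lands in the window and exhausts it, the count is EXACT —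
`#P.Sq k y a j = #W · (L⁴)^{k−j}` (`j ≤ k` inside the tower). [folklore] -/
theorem card_Sq_eq_of_window (P : PieceData C Bg ι α β γ)
    (W : (k : ℕ) → ι → α → Finset (TPt 4 (R.cubesPerDir k)))
    (rq : (k : ℕ) → ι → α → (j : ℕ) → γ → TPt 4 (R.cubesPerDir j))
    (hinj : ∀ (k : ℕ) (y : ι) (a : α) (j : ℕ), Set.InjOn (rq k y a j) ↑(P.Sq k y a j))
    (hrq : ∀ (k : ℕ) (y : ι) (a : α) (j : ℕ), ∀ q ∈ P.Sq k y a j,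
      j ≤ k ∧ k + R.m' ≤ R.F.m + R.K ∧ coarsen R j k (rq k y a j q) ∈ W k y a)
    (hsurj : ∀ (k : ℕ) (y : ι) (a : α) (j : ℕ), j ≤ k → k + R.m' ≤ R.F.m + R.K →
      ∀ b : TPt 4 (R.cubesPerDir j), coarsen R j k b ∈ W k y a → ∃ q ∈ P.Sq k y a j, rq k y a j q = b)
    {k j : ℕ} (hjk : j ≤ k) (hk : k + R.m' ≤ R.F.m + R.K) (y : ι) (a : α) :
    ((P.Sq k y a j).card : ℝ) = ((W k y a).card : ℝ) * ((R.F.L : ℝ) ^ 4) ^ (k - j) := by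
  classical
  rw [← card_filter_coarsen_mem_real R hjk hk (W k y a), ← Finset.card_image_of_injOn (hinj k y a j)]
  congr 2
  ext b
  simp only [Finset.mem_image, Finset.mem_filter, Finset.mem_univ, true_and]
  constructor
  · rintro ⟨q, hq, rfl⟩
    exact (hrq k y a j q hq).2.2
  · intro hb
    obtain ⟨q, hq, hqb⟩ := hsurj k y a j hjk hk b hb
    exact ⟨q, hq, hqb⟩

end Record

end Summit.QuantumFields.BalabanUV.T4Continuum.NE9LevelCountsWindow

end
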